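/-
Copyright (c) 2026 the pub-hodgecm-mathlib formalisation cell (harness21).  Prover seat hodgecm-mathlib-K2Liu-p11 (g0), Track B «K2-LIT»,
#184♮ = hLiu418 = `stmt-HodgeConjecture-24832`; LEAD F0P6-plan (g12) RULING M-156n (4) «A∞ ORGAN»; K2E5-plan (g6) 08:24:53Z «= n = 2 by hand».
File (A∞-B1), part 2: the base trigonometric Beta integral `∫_{−π/2}^{π/2} cos^a θ dθ = B(½, (a+1)/2)` (Mathlib-only).  THEOREMS ONLY.
-/
import Summits.HodgeConjecture.HodgeConjecture.Theorems.K2LiuCayleyBetaIntegral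
import Summits.HodgeConjecture.HodgeConjecture.Theorems.K2E1ArchWhittakerContinuationU3   -- ★ `ofReal_sq_cpow` (`(x²)^w = x^{2w}`, reused)
import HarnessLib

/-!
# Crux `HLiu418`, A∞ organ, (A∞-B1) part 2: `∫_{−π/2}^{π/2} (cos θ)^a dθ = B(½, (a+1)/2) = Γ(½) Γ((a+1)/2) / Γ(a/2 + 1)`

Cell `hodgecm-mathlib`, crux item hLiu418 = `stmt-HodgeConjecture-24832` (helper lane `--supports`, count-neutral).
For `0 < re a` (the range the A∞ organ uses: `a = 2s`, `re s > ½`), with complex powers of the POSITIVE real `cos θ` on `(−π/2, π/2)`: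
* `cpow_mul_self_ofReal` — `x ^ w · x = x ^ (w+1)` for `x > 0` (★ `ofReal_sq_cpow` gives `(x²)^w = x^{2w}`);
* `integral_cos_cpow_half` — `∫_{θ ∈ (0, π/2)} (cos θ)^a = ½ · B(½, (a+1)/2)` (★ part 1 `integral_Ioo_comp_sin_sq` + Mathlib `Complex.betaIntegral`);
* `integral_cos_cpow` — `∫_{θ ∈ (−π/2, π/2)} (cos θ)^a = B(½, (a+1)/2)` (evenness), and `… = Γ(½)·Γ((a+1)/2) / Γ(a/2+1)`
  (`integral_cos_cpow_eq_Gamma`; ★ `Complex.Gamma_mul_Gamma_eq_betaIntegral`).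
References: [folklore] (Euler); used for [Shimura1982, (1.16)] at `n = 2` (acq-15218 open — derived here, not cited).
HONEST LABEL: HC_CM is proved only modulo the 7 printed citations (2 remaining named inputs: hLiu418 = stmt-HodgeConjecture-24832,
h413 = stmt-HodgeConjecture-24833) until rung 0 closes; count-neutral helper, closes no socket.
-/

set_option autoImplicit false
set_option linter.dupNamespace false

noncomputable section

open Real Set MeasureTheory Complex
open Summit.HodgeConjecture.HodgeConjecture.Cruxes.HLiu418.K2LiuCayleyBetaIntegral
open Summit.HodgeConjecture.HodgeConjecture.Cruxes.H413.K2E1ArchWhittakerContinuationU3 (ofReal_sq_cpow)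

namespace Summit.HodgeConjecture.HodgeConjecture.Cruxes.HLiu418.K2LiuCosPowBeta

/-! ## 1. Complex powers of positive reals (`(x²)^w = x^{2w}` is ★ `ofReal_sq_cpow`) -/

/-- `x^w · x = x^{w+1}` for a positive real base. [folklore] -/
theorem cpow_mul_self_ofReal {x : ℝ} (hx : 0 < x) (w : ℂ) : ((x : ℝ) : ℂ) ^ w * ((x : ℝ) : ℂ) = ((x : ℝ) : ℂ) ^ (w + 1) := by
  have hx0 : ((x : ℝ) : ℂ) ≠ 0 := by exact_mod_cast hx.ne'
  rw [Complex.cpow_add _ _ hx0, Complex.cpow_one]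

/-! ## 2. The half-interval integral -/

/-- **`∫_{(0, π/2)} (cos θ)^a dθ = ½ B(½, (a+1)/2)`** (substitution `t = sin² θ` into Euler's Beta integral). [folklore] -/
theorem integral_cos_cpow_half (a : ℂ) :
    ∫ θ in Ioo (0 : ℝ) (π / 2), ((Real.cos θ : ℝ) : ℂ) ^ a = (1 / 2 : ℂ) * Complex.betaIntegral (1 / 2) ((a + 1) / 2) := by
  -- Euler's integral as a set integral over `(0, 1)`, pulled back by `t = sin² θ`
  have hB : Complex.betaIntegral (1 / 2) ((a + 1) / 2) =
      ∫ t in Ioo (0 : ℝ) 1, ((t : ℝ) : ℂ) ^ ((1 / 2 : ℂ) - 1) * (1 - ((t : ℝ) : ℂ)) ^ ((a + 1) / 2 - 1) := by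
    rw [Complex.betaIntegral, intervalIntegral.integral_of_le zero_le_one, integral_Ioc_eq_integral_Ioo]
  rw [hB, integral_Ioo_comp_sin_sq, ← integral_const_mul]
  refine setIntegral_congr_fun measurableSet_Ioo fun θ hθ => ?_
  have hs : 0 < Real.sin θ := Real.sin_pos_of_mem_Ioo ⟨hθ.1, hθ.2.trans (by linarith [Real.pi_pos])⟩
  have hc : 0 < Real.cos θ := Real.cos_pos_of_mem_Ioo ⟨by linarith [hθ.1, Real.pi_pos], hθ.2⟩
  have hs0 : ((Real.sin θ : ℝ) : ℂ) ≠ 0 := by exact_mod_cast hs.ne'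
  have e1 : (((Real.sin θ ^ 2 : ℝ)) : ℂ) ^ ((1 / 2 : ℂ) - 1) = (((Real.sin θ : ℝ) : ℂ))⁻¹ := by
    rw [ofReal_sq_cpow hs, show (2 : ℂ) * ((1 / 2 : ℂ) - 1) = -1 by norm_num, Complex.cpow_neg_one]
  have e2 : (1 : ℂ) - (((Real.sin θ ^ 2 : ℝ)) : ℂ) = (((Real.cos θ ^ 2 : ℝ)) : ℂ) := by
    have h : (1 : ℝ) - Real.sin θ ^ 2 = Real.cos θ ^ 2 := by nlinarith [Real.sin_sq_add_cos_sq θ]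
    exact_mod_cast h
  have e3 : (((Real.cos θ ^ 2 : ℝ)) : ℂ) ^ ((a + 1) / 2 - 1) = ((Real.cos θ : ℝ) : ℂ) ^ (a - 1) := by
    rw [ofReal_sq_cpow hc]
    congr 1
    ring
  rw [Complex.real_smul, e1, e2, e3, Complex.ofReal_mul, Complex.ofReal_mul, Complex.ofReal_ofNat]
  rw [show (1 : ℂ) / 2 * (2 * (Real.sin θ : ℂ) * (Real.cos θ : ℂ) * (((Real.sin θ : ℂ))⁻¹ * ((Real.cos θ : ℂ)) ^ (a - 1))) =
      ((Real.sin θ : ℂ) * ((Real.sin θ : ℂ))⁻¹) * (((Real.cos θ : ℂ)) ^ (a - 1) * (Real.cos θ : ℂ)) by ring,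
    mul_inv_cancel₀ hs0, one_mul, cpow_mul_self_ofReal hc, sub_add_cancel]

/-! ## 3. The full interval and the Gamma form -/

/-- Continuity of `θ ↦ (cos θ)^a` for `0 < re a`. [folklore] -/
theorem continuous_cos_cpow {a : ℂ} (ha : 0 < a.re) : Continuous fun θ : ℝ => ((Real.cos θ : ℝ) : ℂ) ^ a :=
  (Complex.continuous_ofReal_cpow_const ha).comp Real.continuous_cos

/-- **`∫_{(−π/2, π/2)} (cos θ)^a dθ = B(½, (a+1)/2)`** for `0 < re a` (evenness of `cos`). [folklore] -/
theorem integral_cos_cpow {a : ℂ} (ha : 0 < a.re) :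
    ∫ θ in Ioo (-(π / 2)) (π / 2), ((Real.cos θ : ℝ) : ℂ) ^ a = Complex.betaIntegral (1 / 2) ((a + 1) / 2) := by
  have hc := continuous_cos_cpow ha
  have hpi : 0 ≤ π / 2 := by positivity
  -- as interval integrals
  have hfull : ∫ θ in Ioo (-(π / 2)) (π / 2), ((Real.cos θ : ℝ) : ℂ) ^ a = ∫ θ in (-(π / 2))..(π / 2), ((Real.cos θ : ℝ) : ℂ) ^ a := by
    rw [intervalIntegral.integral_of_le (by linarith), integral_Ioc_eq_integral_Ioo]
  have hhalf : ∫ θ in Ioo (0 : ℝ) (π / 2), ((Real.cos θ : ℝ) : ℂ) ^ a = ∫ θ in (0 : ℝ)..(π / 2), ((Real.cos θ : ℝ) : ℂ) ^ a := by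
    rw [intervalIntegral.integral_of_le hpi, integral_Ioc_eq_integral_Ioo]
  have hsplit := intervalIntegral.integral_add_adjacent_intervals (hc.intervalIntegrable (μ := volume) (-(π / 2)) 0)
    (hc.intervalIntegrable (μ := volume) 0 (π / 2))
  have hneg : ∫ θ in (-(π / 2))..0, ((Real.cos θ : ℝ) : ℂ) ^ a = ∫ θ in (0 : ℝ)..(π / 2), ((Real.cos θ : ℝ) : ℂ) ^ a := by
    have h := intervalIntegral.integral_comp_neg (a := 0) (b := π / 2) (fun θ : ℝ => ((Real.cos θ : ℝ) : ℂ) ^ a)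
    simp only [Real.cos_neg, neg_zero] at h
    exact h.symm
  rw [hfull, ← hsplit, hneg, ← hhalf, integral_cos_cpow_half]
  ring

/-- **Gamma form**: `∫_{(−π/2, π/2)} (cos θ)^a dθ = Γ(½) Γ((a+1)/2) / Γ(a/2 + 1)` for `0 < re a`. [folklore] -/
theorem integral_cos_cpow_eq_Gamma {a : ℂ} (ha : 0 < a.re) :
    ∫ θ in Ioo (-(π / 2)) (π / 2), ((Real.cos θ : ℝ) : ℂ) ^ a =
      Complex.Gamma (1 / 2) * Complex.Gamma ((a + 1) / 2) / Complex.Gamma (a / 2 + 1) := by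
  rw [integral_cos_cpow ha]
  have h1 : (0 : ℝ) < (1 / 2 : ℂ).re := by norm_num
  have h2 : (0 : ℝ) < ((a + 1) / 2 : ℂ).re := by
    have : ((a + 1) / 2 : ℂ).re = (a.re + 1) / 2 := by simp [Complex.add_re, Complex.div_ofNat_re]
    rw [this]; linarith
  have h3 : Complex.Gamma (a / 2 + 1) ≠ 0 := Complex.Gamma_ne_zero_of_re_pos (by
    have : (a / 2 + 1 : ℂ).re = a.re / 2 + 1 := by simp [Complex.add_re, Complex.div_ofNat_re]
    rw [this]; linarith)
  have hB := Complex.Gamma_mul_Gamma_eq_betaIntegral h1 h2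
  rw [show (1 / 2 : ℂ) + (a + 1) / 2 = a / 2 + 1 by ring] at hB
  rw [eq_div_iff h3, mul_comm, ← hB]

end Summit.HodgeConjecture.HodgeConjecture.Cruxes.HLiu418.K2LiuCosPowBeta

end
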